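import Summits.ValiantsHypothesis.ValiantsHypothesis.Theorems.SymPencilPerFourW2Levers
import Summits.ValiantsHypothesis.ValiantsHypothesis.Theorems.SymPencilPerFourW2Lever
import Summits.ValiantsHypothesis.ValiantsHypothesis.Theorems.SymPencilPerFourW2LeverTwentySeven
import Summits.ValiantsHypothesis.ValiantsHypothesis.Theorems.SymPencilPerFourW2Columns

/-!
# Route `SymPencil` — row `r = 10` of the size-`28` table: the threshold-shifted declarations of
# `SymPencilPerFourW2Levers` (`--supports` stmt-ValiantsHypothesis-5674 `SdcSuperquadratic`; rung currency only)

The declarations below (suffix `_m28`) are those of the landed `…Theorems.SymPencilPerFourW2Levers` whose meaning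
changes when its numerical thresholds move by one unit — `Fin 6 → Fin 7` square families /
`|ι'| ≤ 26 → ≤ 27` / `m ≤ 27 → m ≤ 28`, as applicable — with proofs VERBATIM; unchanged
declarations are used from the original module by name (same namespace).  Why it elaborates
(m = 28 table audit, val-lit-p6 g17, 2026-08-29; reader of record val-idea-crit-5 g4, probe P31):
the leaves of the `(10, 6)` chain are stated for `card ι < 8` / `< 9`, and every size lever reads
`4·rk bL ≤ 2·dim K + |ι'|` through integer division — one unit of slack throughout.  The `_m28`
statements imply the landed ones.

Honest framing: part of ONE row (cell `(10, 6, 7)`) of the size-`28` table; nothing about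
`sdc(per_4)` follows here; `28 ≤ sdc(per_4) ≤ 29` of record, the crux `SdcSuperquadratic` and
`VP ≠ VNP` untouched.  Credit: mathematics and proof text of `SymPencilPerFourW2Levers` (its authors); this file only
moves the bound.  No definitions, no named facts. [folklore]
-/

noncomputable section

-- single-conjunct layout: Sub = Summit, duplicated namespace component intended
set_option linter.dupNamespace false

namespace Summit.ValiantsHypothesis.ValiantsHypothesis.Theorems.SymPencilPerFourW2Levers

open Matrix MvPolynomial Module
open Literature.Computability.AlgebraicComplexity
open Summit.ValiantsHypothesis.ValiantsHypothesis.Theorems.SymPencilAffineKernelLever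
open Summit.ValiantsHypothesis.ValiantsHypothesis.Theorems.SymPencilSdcPerFourTwentySeven
open Summit.ValiantsHypothesis.ValiantsHypothesis.Theorems.SymPencilPerFourW2Forms
open Summit.ValiantsHypothesis.ValiantsHypothesis.Theorems.SymPencilPerFourW2Columns
open Summit.ValiantsHypothesis.ValiantsHypothesis.Theorems.SymPencilPerFourW2Lever

universe u

variable {k : Type u} [Field k]

variable [CharZero k] {ι' : Type*} [Fintype ι'] [DecidableEq ι']

/-- **The `a`-lever of `W₂`**: `dim K_a ≥ 7` and `K_a ⊆ bU (X⁺)` or `K_a ⊆ bU (X⁻)`. [folklore] -/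
theorem w2_lever_a_m28 {D : Matrix ι' ι' k} (hD : IsUnit D.det) (hDs : Dᵀ = D)
    (bL : (Fin 4 × Fin 4 → k) →ₗ[k] (ι' → k)) (CL : (Fin 4 × Fin 4 → k) →ₗ[k] Matrix ι' ι' k)
    (hCs : ∀ z, (CL z)ᵀ = CL z) {κ : k} (hκ : κ ≠ 0)
    (hii : ∀ z, bL z ⬝ᵥ (D⁻¹ * CL z * D⁻¹) *ᵥ bL z = 0)
    (hN : ∀ v, bL v = 0 → IsUnit (D + CL v).det ∧ ∀ (z : Fin 4 × Fin 4 → k) (s : k),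
      κ * MvPolynomial.eval (v + s • z) (perPoly (Fin 4) k) =
        (Matrix.fromBlocks ((s * 0) • (1 : Matrix Unit Unit k))
          (Matrix.replicateRow Unit (s • bL z)) (Matrix.replicateCol Unit (s • bL z))
          (D + CL v + s • CL z)).det)
    (hker : ∀ x : Fin 4 × Fin 4 → k,
      bL x = 0 ↔ ∀ z : Fin 4 × Fin 4, ¬ (z.1 = 0 ∨ z = (1, 0) ∨ z = (1, 1)) → x z = 0)
    (h10 : 10 ≤ finrank k (LinearMap.range bL)) (hcard : Fintype.card ι' ≤ 27) :
    7 ≤ finrank k (LinearMap.range bL ⊓ (LinearMap.range bL).comap (CL (fun z : Fin 4 × Fin 4 =>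
          (Matrix.of ![![0, 1, 1, 1], ![0, 0, 0, 0], ![0, 0, 0, 0], ![0, 0, 0, 0]]) z.1 z.2) * D⁻¹).mulVecLin :
        Submodule k (ι' → k)) ∧
    ((∀ y ∈ (LinearMap.range bL ⊓ (LinearMap.range bL).comap (CL (fun z : Fin 4 × Fin 4 =>
          (Matrix.of ![![0, 1, 1, 1], ![0, 0, 0, 0], ![0, 0, 0, 0], ![0, 0, 0, 0]]) z.1 z.2) * D⁻¹).mulVecLin :
        Submodule k (ι' → k)), ∃ u : (Fin 2 × Fin 3 → k) × (Fin 4 → k),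
        (u.1 (1, 1) = 0 ∧ u.1 (1, 2) = 0 ∧ u.1 (0, 1) + u.1 (0, 2) = 0) ∧ y = bL (fun z : Fin 4 × Fin 4 => (Matrix.of ![![0, 0, 0, 0], ![0, 0, u.2 0, u.2 1],
        ![u.2 2, u.1 (0, 0), u.1 (0, 1), u.1 (0, 2)], ![u.2 3, u.1 (1, 0), u.1 (1, 1), u.1 (1, 2)]])
        z.1 z.2)) ∨
     (∀ y ∈ (LinearMap.range bL ⊓ (LinearMap.range bL).comap (CL (fun z : Fin 4 × Fin 4 =>
          (Matrix.of ![![0, 1, 1, 1], ![0, 0, 0, 0], ![0, 0, 0, 0], ![0, 0, 0, 0]]) z.1 z.2) * D⁻¹).mulVecLin :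
        Submodule k (ι' → k)), ∃ u : (Fin 2 × Fin 3 → k) × (Fin 4 → k),
        (u.1 (0, 1) = 0 ∧ u.1 (0, 2) = 0 ∧ u.1 (1, 1) + u.1 (1, 2) = 0) ∧ y = bL (fun z : Fin 4 × Fin 4 => (Matrix.of ![![0, 0, 0, 0], ![0, 0, u.2 0, u.2 1],
        ![u.2 2, u.1 (0, 0), u.1 (0, 1), u.1 (0, 2)], ![u.2 3, u.1 (1, 0), u.1 (1, 1), u.1 (1, 2)]])
        z.1 z.2))) := by
  refine w2_lever_core_m28 hD hDs bL CL hCs hκ hN hker h10 hcard _ 0 (fun t i j hi => w2_a_row t i j hi)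
    (fun t => (hker _).2 (w2_a_support t)) _ _ ?_ ?_ ?_
  · intro c₁ c₂ u w hu hw
    simp only [Prod.fst_add, Prod.smul_fst, Pi.add_apply, Pi.smul_apply, smul_eq_mul]
    refine ⟨?_, ?_, ?_⟩
    · rw [hu.1, hw.1]; ring
    · rw [hu.2.1, hw.2.1]; ring
    · linear_combination c₁ * hu.2.2 + c₂ * hw.2.2
  · intro c₁ c₂ u w hu hw
    simp only [Prod.fst_add, Prod.smul_fst, Pi.add_apply, Pi.smul_apply, smul_eq_mul]
    refine ⟨?_, ?_, ?_⟩
    · rw [hu.1, hw.1]; ring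
    · rw [hu.2.1, hw.2.1]; ring
    · linear_combination c₁ * hu.2.2 + c₂ * hw.2.2
  · intro t ht S h7 hxS
    refine w2_classify_a S (fun u hu => ?_) (fun u hu => ?_) h7
    · obtain ⟨z₀, hx⟩ := hxS u hu
      have h := (w2_forms_vanish_a hDs bL CL hCs hκ hii hN hker t ht _ z₀ hx).1
      simpa only [Matrix.of_apply, Matrix.cons_val] using h
    · obtain ⟨z₀, hx⟩ := hxS u hu
      have h := (w2_forms_vanish_a hDs bL CL hCs hκ hii hN hker t ht _ z₀ hx).2
      simpa only [Matrix.of_apply, Matrix.cons_val] using h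
/-- **The `b`-lever of `W₂`**: `dim K_b ≥ 7` and `K_b ⊆ bU (Y⁺)` or `K_b ⊆ bU (Y⁻)`. [folklore] -/
theorem w2_lever_b_m28 {D : Matrix ι' ι' k} (hD : IsUnit D.det) (hDs : Dᵀ = D)
    (bL : (Fin 4 × Fin 4 → k) →ₗ[k] (ι' → k)) (CL : (Fin 4 × Fin 4 → k) →ₗ[k] Matrix ι' ι' k)
    (hCs : ∀ z, (CL z)ᵀ = CL z) {κ : k} (hκ : κ ≠ 0)
    (hii : ∀ z, bL z ⬝ᵥ (D⁻¹ * CL z * D⁻¹) *ᵥ bL z = 0)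
    (hN : ∀ v, bL v = 0 → IsUnit (D + CL v).det ∧ ∀ (z : Fin 4 × Fin 4 → k) (s : k),
      κ * MvPolynomial.eval (v + s • z) (perPoly (Fin 4) k) =
        (Matrix.fromBlocks ((s * 0) • (1 : Matrix Unit Unit k))
          (Matrix.replicateRow Unit (s • bL z)) (Matrix.replicateCol Unit (s • bL z))
          (D + CL v + s • CL z)).det)
    (hker : ∀ x : Fin 4 × Fin 4 → k,
      bL x = 0 ↔ ∀ z : Fin 4 × Fin 4, ¬ (z.1 = 0 ∨ z = (1, 0) ∨ z = (1, 1)) → x z = 0)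
    (h10 : 10 ≤ finrank k (LinearMap.range bL)) (hcard : Fintype.card ι' ≤ 27) :
    7 ≤ finrank k (LinearMap.range bL ⊓ (LinearMap.range bL).comap (CL (fun z : Fin 4 × Fin 4 =>
          (Matrix.of ![![0, 0, 0, 0], ![1, 0, 0, 0], ![0, 0, 0, 0], ![0, 0, 0, 0]]) z.1 z.2) * D⁻¹).mulVecLin :
        Submodule k (ι' → k)) ∧
    ((∀ y ∈ (LinearMap.range bL ⊓ (LinearMap.range bL).comap (CL (fun z : Fin 4 × Fin 4 =>
          (Matrix.of ![![0, 0, 0, 0], ![1, 0, 0, 0], ![0, 0, 0, 0], ![0, 0, 0, 0]]) z.1 z.2) * D⁻¹).mulVecLin :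
        Submodule k (ι' → k)), ∃ u : (Fin 2 × Fin 3 → k) × (Fin 4 → k),
        (∀ j : Fin 3, u.1 (0, j) = 0) ∧ y = bL (fun z : Fin 4 × Fin 4 => (Matrix.of ![![0, 0, 0, 0], ![0, 0, u.2 0, u.2 1],
        ![u.2 2, u.1 (0, 0), u.1 (0, 1), u.1 (0, 2)], ![u.2 3, u.1 (1, 0), u.1 (1, 1), u.1 (1, 2)]])
        z.1 z.2)) ∨
     (∀ y ∈ (LinearMap.range bL ⊓ (LinearMap.range bL).comap (CL (fun z : Fin 4 × Fin 4 =>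
          (Matrix.of ![![0, 0, 0, 0], ![1, 0, 0, 0], ![0, 0, 0, 0], ![0, 0, 0, 0]]) z.1 z.2) * D⁻¹).mulVecLin :
        Submodule k (ι' → k)), ∃ u : (Fin 2 × Fin 3 → k) × (Fin 4 → k),
        (∀ j : Fin 3, u.1 (1, j) = 0) ∧ y = bL (fun z : Fin 4 × Fin 4 => (Matrix.of ![![0, 0, 0, 0], ![0, 0, u.2 0, u.2 1],
        ![u.2 2, u.1 (0, 0), u.1 (0, 1), u.1 (0, 2)], ![u.2 3, u.1 (1, 0), u.1 (1, 1), u.1 (1, 2)]])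
        z.1 z.2))) := by
  refine w2_lever_core_m28 hD hDs bL CL hCs hκ hN hker h10 hcard _ 1 (fun t i j hi => w2_b_row t i j hi)
    (fun t => (hker _).2 (w2_b_support t)) _ _ ?_ ?_ ?_
  · intro c₁ c₂ u w hu hw j
    simp only [Prod.fst_add, Prod.smul_fst, Pi.add_apply, Pi.smul_apply, smul_eq_mul, hu j, hw j,
      mul_zero, add_zero]
  · intro c₁ c₂ u w hu hw j
    simp only [Prod.fst_add, Prod.smul_fst, Pi.add_apply, Pi.smul_apply, smul_eq_mul, hu j, hw j,
      mul_zero, add_zero]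
  · intro t ht S h7 hxS
    refine w2_classify_b S (fun u hu j j' hjj' => ?_) h7
    obtain ⟨z₀, hx⟩ := hxS u hu
    obtain ⟨h23, h13, h12⟩ := w2_forms_vanish_b hDs bL CL hCs hκ hii hN hker t ht _ z₀ hx
    simp only [Matrix.of_apply, Matrix.cons_val] at h23 h13 h12
    have hj3 : ∀ i : Fin 3, i = 0 ∨ i = 1 ∨ i = 2 := by
      intro i; fin_cases i <;> simp
    rcases hj3 j with rfl | rfl | rfl <;> rcases hj3 j' with rfl | rfl | rfl
    all_goals first
      | exact absurd rfl hjj'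
      | linear_combination h12
      | linear_combination h13
      | linear_combination h23
end Summit.ValiantsHypothesis.ValiantsHypothesis.Theorems.SymPencilPerFourW2Levers

end
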